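import Summits.AnomalousDissipation.AnomalousDissipation.Theorems.SolenoidalFractalHomogenisationLagrangianStepCellLawVOddGainDefectSectorialWindow
import Mathlib.MeasureTheory.Integral.IntervalIntegral.FundThmCalculus
import HarnessLib

/-!
# K1L `LagrangianRenormalisationStep(Design)` (K1L_D, stmt-AnomalousDissipation-27980; aside 24912), stub `stub_cellLawV0_IS`
# — W5 odd half, O2⁺ (i): the DUHAMEL PAIRING IDENTITY for two matrix semigroups and the first-order drift of a SECTORIAL block
# (helper; `--supports stmt-AnomalousDissipation-27980`; word-independent)

Summits-side helper file of route `SolenoidalFractalHomogenisation` (prover seat `ad-k1l-cellLawV-w1` g2, successor (w-c) seat; tenure D24-10 /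
D24-14 «prove `LowerEdgeTarget`»), first of two files (this one; `…CellLawVOddGainDefectLowerEdge.lean` integrates it against the slot kernel and
PROVES p5 §5's typed target `OddGain.LowerEdgeTarget ρ`, p652418/p652780 `…CellLawVOddGainDefectSectorialWindow`).  Everything PROVED, no definition,
no named fact, no sorry.

* §1 **`pairing_identity`** (any dimension `m`, any two generators `B`, `C`, no symmetry, no commutation):
  `z·(e^{-tB}v) − (e^{-tC}z)·v = ∫₀ᵗ [(C e^{-(t-r)C}z)·(e^{-rB}v) − (e^{-(t-r)C}z)·(B e^{-rB}v)] dr` — the fundamental theorem of calculus for the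
  pairing `ψ(r) = (e^{-(t-r)C}z)·(e^{-rB}v)` (derivatives from ad-lit's `hasDerivAt_exp_neg_smul_mulVec`, p635350); the integrand is the commutator
  form `(e^{-(t-r)C}z)·((Cᵀ − B)e^{-rB}v)` (`pairing_integrand_eq`).  This replaces the variation-of-constants formula (no integral of
  matrix-valued functions is needed).
* §2 toolkit in the `⬝ᵥ` currency (`Fin 3`): Cauchy–Schwarz, the symmetric part `H = ½(B + Bᵀ)` (`isSymm_symPart`, `form_symPart(_self)`,
  `symPart_transpose_sub`: `Hᵀ − B = ½(Bᵀ − B)`), the skew bound in operator form `|y·((Bᵀ − B)x)| ≤ τ·hi·√(y·y)√(x·x)` from p5's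
  `skew_sq_le_of_sector`, contractivity `√((e^{-tB}v)·(e^{-tB}v)) ≤ e^{-lo t}√(v·v)` and the symmetric lower pinch (ad-lit p636892 by name).
* §3 for a block `B` in the Kato sector `τ` with window `lo|x|² ≤ xᵀBx ≤ hi|x|²` (`0 < lo`) and `t ≥ 0`:
  **`abs_dotProduct_exp_sub_exp_symPart_le`** `|z·(e^{-tB}v) − z·(e^{-tH}v)| ≤ (τhi/2)·t·e^{-lo t}√(z·z)√(v·v)` (pairing identity with `C = H`,
  integrand bounded uniformly in `r`); **`sqrt_dotProduct_exp_sub_exp_symPart_le`** `|e^{-tB}v − e^{-tH}v| ≤ (τhi/2)·t·e^{-lo t}|v|` (test at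
  `z = w(t)`); **`lowerEdge_pointwise_first`** `vᵀe^{-tB}v ≥ (e^{-hi t} − (τhi/2)·t·e^{-lo t})|v|²` — the pointwise form of p5's `LowerEdgeTarget`.
Infrastructure for route-1's rung leaf F-D1.A0 (frontier FORMAL rung); NOT a proof of the stub, of the crux, of Onsager's conjecture or of anomalous
dissipation.  Prover seat `ad-k1l-cellLawV-w1` g2, 2026-08-28.
-/

set_option linter.dupNamespace false

noncomputable section

namespace Summit.AnomalousDissipation.AnomalousDissipation.Theorems.SolenoidalFractalHomogenisation.LagrangianStep.OddGain

open Matrix Finset MeasureTheory Set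
open Literature.Analysis.ODE.PeriodicAveraging

/-! ## §1 The Duhamel PAIRING identity (any dimension, any two generators) -/

section Pairing

variable {m : ℕ}

/-- The reversed orbit `r ↦ e^{-(t-r)C} z` is differentiable with derivative `C e^{-(t-r)C} z` (chain rule on p635350's
`hasDerivAt_exp_neg_smul_mulVec`). [folklore] -/
theorem hasDerivAt_exp_neg_sub_smul_mulVec (C : Matrix (Fin m) (Fin m) ℝ) (z : Fin m → ℝ) (t r : ℝ) :
    HasDerivAt (fun r : ℝ => (NormedSpace.exp (-((t - r) • C))) *ᵥ z)
      (C *ᵥ ((NormedSpace.exp (-((t - r) • C))) *ᵥ z)) r := by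
  have h1 := hasDerivAt_exp_neg_smul_mulVec C z (t - r)
  have h2 : HasDerivAt (fun r : ℝ => t - r) (-1) r := (hasDerivAt_id' r).const_sub t
  have h := h1.scomp r h2
  refine h.congr_deriv ?_
  rw [neg_one_smul, neg_neg]

/-- The reversed orbit is continuous. [folklore] -/
theorem continuous_exp_neg_sub_smul_mulVec (C : Matrix (Fin m) (Fin m) ℝ) (z : Fin m → ℝ) (t : ℝ) :
    Continuous fun r : ℝ => (NormedSpace.exp (-((t - r) • C))) *ᵥ z :=
  (continuous_exp_neg_smul_mulVec C z).comp' (continuous_const.sub continuous_id)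

/-- Derivative of the PAIRING `ψ(r) = (e^{-(t-r)C} z)·(e^{-rB} v)`: `ψ'(r) = (C e^{-(t-r)C} z)·(e^{-rB} v) − (e^{-(t-r)C} z)·(B e^{-rB} v)`.
[folklore] -/
theorem hasDerivAt_pairing (B C : Matrix (Fin m) (Fin m) ℝ) (v z : Fin m → ℝ) (t r : ℝ) :
    HasDerivAt (fun r : ℝ => ((NormedSpace.exp (-((t - r) • C))) *ᵥ z) ⬝ᵥ ((NormedSpace.exp (-(r • B))) *ᵥ v))
      ((C *ᵥ ((NormedSpace.exp (-((t - r) • C))) *ᵥ z)) ⬝ᵥ ((NormedSpace.exp (-(r • B))) *ᵥ v) -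
        ((NormedSpace.exp (-((t - r) • C))) *ᵥ z) ⬝ᵥ (B *ᵥ ((NormedSpace.exp (-(r • B))) *ᵥ v))) r := by
  have hf := hasDerivAt_exp_neg_sub_smul_mulVec C z t r
  have hg := hasDerivAt_exp_neg_smul_mulVec B v r
  rw [hasDerivAt_pi] at hf hg
  have h := HasDerivAt.fun_sum (u := Finset.univ) fun i _ => (hf i).mul (hg i)
  show HasDerivAt (fun r : ℝ => ∑ i, ((NormedSpace.exp (-((t - r) • C))) *ᵥ z) i *
    ((NormedSpace.exp (-(r • B))) *ᵥ v) i) _ r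
  refine h.congr_deriv ?_
  simp only [dotProduct, Pi.neg_apply, mul_neg, Finset.sum_add_distrib, Finset.sum_neg_distrib, sub_eq_add_neg]

/-- The derivative of the pairing is continuous in `r`. [folklore] -/
theorem continuous_pairing_deriv (B C : Matrix (Fin m) (Fin m) ℝ) (v z : Fin m → ℝ) (t : ℝ) :
    Continuous fun r : ℝ => (C *ᵥ ((NormedSpace.exp (-((t - r) • C))) *ᵥ z)) ⬝ᵥ ((NormedSpace.exp (-(r • B))) *ᵥ v) -
        ((NormedSpace.exp (-((t - r) • C))) *ᵥ z) ⬝ᵥ (B *ᵥ ((NormedSpace.exp (-(r • B))) *ᵥ v)) :=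
  ((continuous_const.matrix_mulVec (continuous_exp_neg_sub_smul_mulVec C z t)).dotProduct
      (continuous_exp_neg_smul_mulVec B v)).sub
    ((continuous_exp_neg_sub_smul_mulVec C z t).dotProduct
      (continuous_const.matrix_mulVec (continuous_exp_neg_smul_mulVec B v)))

/-- **THE DUHAMEL PAIRING IDENTITY** (two generators `B`, `C`, no symmetry, no commutation):
`z·(e^{-tB} v) − (e^{-tC} z)·v = ∫₀ᵗ [(C e^{-(t-r)C} z)·(e^{-rB} v) − (e^{-(t-r)C} z)·(B e^{-rB} v)] dr`
(fundamental theorem of calculus for the pairing `ψ(r) = (e^{-(t-r)C} z)·(e^{-rB} v)`, `ψ(t) − ψ(0)`). [folklore] -/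
theorem pairing_identity (B C : Matrix (Fin m) (Fin m) ℝ) (v z : Fin m → ℝ) (t : ℝ) :
    z ⬝ᵥ ((NormedSpace.exp (-(t • B))) *ᵥ v) - ((NormedSpace.exp (-(t • C))) *ᵥ z) ⬝ᵥ v =
      ∫ r in (0:ℝ)..t, ((C *ᵥ ((NormedSpace.exp (-((t - r) • C))) *ᵥ z)) ⬝ᵥ ((NormedSpace.exp (-(r • B))) *ᵥ v) -
        ((NormedSpace.exp (-((t - r) • C))) *ᵥ z) ⬝ᵥ (B *ᵥ ((NormedSpace.exp (-(r • B))) *ᵥ v))) := by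
  rw [intervalIntegral.integral_eq_sub_of_hasDerivAt (fun r _ => hasDerivAt_pairing B C v z t r)
    ((continuous_pairing_deriv B C v z t).intervalIntegrable _ _)]
  simp only [sub_self, sub_zero, zero_smul, neg_zero, NormedSpace.exp_zero, Matrix.one_mulVec]

end Pairing

/-! ## §2 Three-dimensional toolkit: Cauchy–Schwarz, the symmetric part `H = (B + Bᵀ)/2`, semigroup bounds in the `⬝ᵥ` currency -/

section Toolkit

/-- Cauchy–Schwarz in the dot-product currency: `|x·y| ≤ √(x·x) √(y·y)`. [folklore] -/
theorem abs_dotProduct_le_sqrt_mul_sqrt (x y : Fin 3 → ℝ) :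
    |x ⬝ᵥ y| ≤ Real.sqrt (x ⬝ᵥ x) * Real.sqrt (y ⬝ᵥ y) := by
  rw [self_dotProduct_eq_sum_sq, self_dotProduct_eq_sum_sq]
  have h1 := Real.sum_mul_le_sqrt_mul_sqrt Finset.univ x y
  have h2 := Real.sum_mul_le_sqrt_mul_sqrt Finset.univ (fun i => -x i) y
  simp only [neg_mul, Finset.sum_neg_distrib, neg_sq] at h2
  rw [abs_le]
  simp only [dotProduct]
  constructor <;> linarith

/-- The window is non-empty: `lo ≤ hi` (test at a unit vector), hence `0 < hi` when `0 < lo`. [folklore] -/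
theorem lo_le_hi_of_window {B : Matrix (Fin 3) (Fin 3) ℝ} {lo hi : ℝ}
    (hwin : ∀ x : Fin 3 → ℝ, lo * (x ⬝ᵥ x) ≤ x ⬝ᵥ B *ᵥ x ∧ x ⬝ᵥ B *ᵥ x ≤ hi * (x ⬝ᵥ x)) : lo ≤ hi := by
  have h := hwin (Pi.single 0 1)
  have h1 : (Pi.single 0 1 : Fin 3 → ℝ) ⬝ᵥ (Pi.single 0 1) = 1 := by simp
  rw [h1, mul_one, mul_one] at h
  exact h.1.trans h.2

/-- The symmetric part `H = ½(B + Bᵀ)` is symmetric. [folklore] -/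
theorem isSymm_symPart (B : Matrix (Fin 3) (Fin 3) ℝ) : ((1 / 2 : ℝ) • (B + Bᵀ)).IsSymm := by
  unfold Matrix.IsSymm
  rw [Matrix.transpose_smul, Matrix.transpose_add, Matrix.transpose_transpose, add_comm]

/-- The bilinear form of the symmetric part: `xᵀHz = ½(xᵀBz + zᵀBx)`. [folklore] -/
theorem form_symPart (B : Matrix (Fin 3) (Fin 3) ℝ) (x z : Fin 3 → ℝ) :
    x ⬝ᵥ ((1 / 2 : ℝ) • (B + Bᵀ)) *ᵥ z = (x ⬝ᵥ B *ᵥ z + z ⬝ᵥ B *ᵥ x) / 2 := by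
  rw [Matrix.smul_mulVec, dotProduct_smul, Matrix.add_mulVec, dotProduct_add, ← form_comm_transpose B x z,
    smul_eq_mul]
  ring

/-- The quadratic form of the symmetric part is that of `B`: `xᵀHx = xᵀBx`. [folklore] -/
theorem form_symPart_self (B : Matrix (Fin 3) (Fin 3) ℝ) (x : Fin 3 → ℝ) :
    x ⬝ᵥ ((1 / 2 : ℝ) • (B + Bᵀ)) *ᵥ x = x ⬝ᵥ B *ᵥ x := by
  rw [form_symPart]; ring

/-- The integrand of the pairing identity is a commutator form: `(Cy)·x − y·(Bx) = y·((Cᵀ − B)x)`. [folklore] -/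
theorem pairing_integrand_eq (B C : Matrix (Fin 3) (Fin 3) ℝ) (y x : Fin 3 → ℝ) :
    (C *ᵥ y) ⬝ᵥ x - y ⬝ᵥ (B *ᵥ x) = y ⬝ᵥ ((Cᵀ - B) *ᵥ x) := by
  rw [dotProduct_comm (C *ᵥ y) x, form_comm_transpose C y x, Matrix.sub_mulVec, dotProduct_sub]

/-- For `C = H = ½(B + Bᵀ)`: `Hᵀ − B = ½(Bᵀ − B) = −K`. [folklore] -/
theorem symPart_transpose_sub (B : Matrix (Fin 3) (Fin 3) ℝ) :
    ((1 / 2 : ℝ) • (B + Bᵀ))ᵀ - B = (1 / 2 : ℝ) • (Bᵀ - B) := by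
  ext i j
  simp [Matrix.sub_apply, Matrix.smul_apply, Matrix.add_apply, Matrix.transpose_apply]
  ring

/-- **The skew part in operator form**: sector `τ` + window `[lo, hi]` (`0 ≤ lo`) give `|y·((Bᵀ − B)x)| ≤ τ·hi·√(y·y)·√(x·x)`
(`skew_sq_le_of_sector` + Cauchy–Schwarz). [folklore] -/
theorem abs_dotProduct_skew_le {B : Matrix (Fin 3) (Fin 3) ℝ} {τ lo hi : ℝ} (hτ : 0 ≤ τ) (hlo : 0 ≤ lo) (hlohi : lo ≤ hi)
    (hsec : ∀ x z : Fin 3 → ℝ, (x ⬝ᵥ B *ᵥ z - z ⬝ᵥ B *ᵥ x) ^ 2 ≤ τ ^ 2 * ((x ⬝ᵥ B *ᵥ x) * (z ⬝ᵥ B *ᵥ z)))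
    (hwin : ∀ x : Fin 3 → ℝ, lo * (x ⬝ᵥ x) ≤ x ⬝ᵥ B *ᵥ x ∧ x ⬝ᵥ B *ᵥ x ≤ hi * (x ⬝ᵥ x)) (y x : Fin 3 → ℝ) :
    |y ⬝ᵥ ((Bᵀ - B) *ᵥ x)| ≤ τ * hi * (Real.sqrt (y ⬝ᵥ y) * Real.sqrt (x ⬝ᵥ x)) := by
  have hk := skew_sq_le_of_sector hlo hsec hwin x
  have hneg : (Bᵀ - B) *ᵥ x = -(B *ᵥ x - Bᵀ *ᵥ x) := by rw [Matrix.sub_mulVec]; abel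
  have hsq : ((Bᵀ - B) *ᵥ x) ⬝ᵥ ((Bᵀ - B) *ᵥ x) ≤ (τ * hi) ^ 2 * (x ⬝ᵥ x) := by
    rw [hneg, neg_dotProduct, dotProduct_neg, neg_neg]; exact hk
  have hcs := abs_dotProduct_le_sqrt_mul_sqrt y ((Bᵀ - B) *ᵥ x)
  have hτhi : 0 ≤ τ * hi := mul_nonneg hτ (hlo.trans hlohi)
  have hroot : Real.sqrt (((Bᵀ - B) *ᵥ x) ⬝ᵥ ((Bᵀ - B) *ᵥ x)) ≤ τ * hi * Real.sqrt (x ⬝ᵥ x) := by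
    calc Real.sqrt (((Bᵀ - B) *ᵥ x) ⬝ᵥ ((Bᵀ - B) *ᵥ x)) ≤ Real.sqrt ((τ * hi) ^ 2 * (x ⬝ᵥ x)) := Real.sqrt_le_sqrt hsq
      _ = τ * hi * Real.sqrt (x ⬝ᵥ x) := by rw [Real.sqrt_mul (sq_nonneg _), Real.sqrt_sq hτhi]
  calc |y ⬝ᵥ ((Bᵀ - B) *ᵥ x)| ≤ Real.sqrt (y ⬝ᵥ y) * Real.sqrt (((Bᵀ - B) *ᵥ x) ⬝ᵥ ((Bᵀ - B) *ᵥ x)) := hcs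
    _ ≤ Real.sqrt (y ⬝ᵥ y) * (τ * hi * Real.sqrt (x ⬝ᵥ x)) := mul_le_mul_of_nonneg_left hroot (Real.sqrt_nonneg _)
    _ = τ * hi * (Real.sqrt (y ⬝ᵥ y) * Real.sqrt (x ⬝ᵥ x)) := by ring

/-- **Contractivity in the `√` currency** (no symmetry): `lo|x|² ≤ xᵀBx` for all `x` gives `√((e^{-tB}v)·(e^{-tB}v)) ≤ e^{-lo t}√(v·v)`
(`t ≥ 0`; ad-lit's `sum_sq_exp_neg_smul_mulVec_le`, p636892). [folklore] -/
theorem sqrt_dotProduct_exp_le {B : Matrix (Fin 3) (Fin 3) ℝ} {lo : ℝ} (hwin : ∀ x : Fin 3 → ℝ, lo * (x ⬝ᵥ x) ≤ x ⬝ᵥ B *ᵥ x)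
    (v : Fin 3 → ℝ) {t : ℝ} (ht : 0 ≤ t) :
    Real.sqrt (((NormedSpace.exp (-(t • B))) *ᵥ v) ⬝ᵥ ((NormedSpace.exp (-(t • B))) *ᵥ v)) ≤
      Real.exp (-(lo * t)) * Real.sqrt (v ⬝ᵥ v) := by
  have ha : ∀ w : Fin 3 → ℝ, lo * ∑ i, w i ^ 2 ≤ ∑ i, ∑ j, w i * B i j * w j := by
    intro w; rw [sum_sum_eq_form, ← self_dotProduct_eq_sum_sq]; exact hwin w
  have h := sum_sq_exp_neg_smul_mulVec_le B ha v ht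
  rw [← self_dotProduct_eq_sum_sq, ← self_dotProduct_eq_sum_sq] at h
  have hexp : Real.exp (-(2 * lo * t)) = Real.exp (-(lo * t)) ^ 2 := by
    rw [sq, ← Real.exp_add]; ring_nf
  calc Real.sqrt (((NormedSpace.exp (-(t • B))) *ᵥ v) ⬝ᵥ ((NormedSpace.exp (-(t • B))) *ᵥ v))
      ≤ Real.sqrt (Real.exp (-(2 * lo * t)) * (v ⬝ᵥ v)) := Real.sqrt_le_sqrt h
    _ = Real.exp (-(lo * t)) * Real.sqrt (v ⬝ᵥ v) := by
        rw [hexp, Real.sqrt_mul (sq_nonneg _), Real.sqrt_sq (Real.exp_pos _).le]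

/-- **Symmetric lower pinch in the `⬝ᵥ` currency**: `H = Hᵀ`, `xᵀHx ≤ hi|x|²` for all `x` ⇒ `e^{-hi t}(v·v) ≤ v·(e^{-tH}v)` (`t ≥ 0`;
ad-lit's `le_dotProduct_exp_neg_smul_mulVec`, p636892). [folklore] -/
theorem exp_mul_le_dotProduct_exp {H : Matrix (Fin 3) (Fin 3) ℝ} (hH : H.IsSymm) {hi : ℝ}
    (hwin : ∀ x : Fin 3 → ℝ, x ⬝ᵥ H *ᵥ x ≤ hi * (x ⬝ᵥ x)) (v : Fin 3 → ℝ) {t : ℝ} (ht : 0 ≤ t) :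
    Real.exp (-(hi * t)) * (v ⬝ᵥ v) ≤ v ⬝ᵥ ((NormedSpace.exp (-(t • H))) *ᵥ v) := by
  have hb : ∀ w : Fin 3 → ℝ, ∑ i, ∑ j, w i * H i j * w j ≤ hi * ∑ i, w i ^ 2 := by
    intro w; rw [sum_sum_eq_form, ← self_dotProduct_eq_sum_sq]; exact hwin w
  have h := le_dotProduct_exp_neg_smul_mulVec hH hb v ht
  rw [← self_dotProduct_eq_sum_sq] at h
  exact h

end Toolkit

/-! ## §3 Pointwise-in-time bounds for a sectorial block: drift, first and second order lower edge, skew part -/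

section Pointwise

/-- The bilinear form of the skew part `½(Bᵀ − B)`: `xᵀ(½(Bᵀ − B))z = ½(zᵀBx − xᵀBz)`. [folklore] -/
theorem form_skewPart (B : Matrix (Fin 3) (Fin 3) ℝ) (x z : Fin 3 → ℝ) :
    x ⬝ᵥ ((1 / 2 : ℝ) • (Bᵀ - B)) *ᵥ z = (z ⬝ᵥ B *ᵥ x - x ⬝ᵥ B *ᵥ z) / 2 := by
  rw [Matrix.smul_mulVec, dotProduct_smul, Matrix.sub_mulVec, dotProduct_sub, ← form_comm_transpose B x z,
    smul_eq_mul]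
  ring

/-- **DRIFT BOUND (first order)**: for a block `B` in the Kato sector `τ` with window `[lo, hi]` (`0 < lo`), its symmetric part
`H = ½(B + Bᵀ)`, every `z, v` and `t ≥ 0`: `|z·(e^{-tB}v) − z·(e^{-tH}v)| ≤ (τhi/2)·t·e^{-lo t}·√(z·z)·√(v·v)`
(pairing identity with `C = H`; the integrand `−(e^{-(t-r)H}z)·(K e^{-rB}v)` is bounded by `(τhi/2)e^{-lo t}√(z·z)√(v·v)` uniformly in `r`,
by the skew bound and contractivity of both semigroups). [folklore] -/
theorem abs_dotProduct_exp_sub_exp_symPart_le {B : Matrix (Fin 3) (Fin 3) ℝ} {τ lo hi : ℝ} (hτ : 0 ≤ τ) (hlo : 0 < lo)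
    (hsec : ∀ x z : Fin 3 → ℝ, (x ⬝ᵥ B *ᵥ z - z ⬝ᵥ B *ᵥ x) ^ 2 ≤ τ ^ 2 * ((x ⬝ᵥ B *ᵥ x) * (z ⬝ᵥ B *ᵥ z)))
    (hwin : ∀ x : Fin 3 → ℝ, lo * (x ⬝ᵥ x) ≤ x ⬝ᵥ B *ᵥ x ∧ x ⬝ᵥ B *ᵥ x ≤ hi * (x ⬝ᵥ x)) (z v : Fin 3 → ℝ) {t : ℝ}
    (ht : 0 ≤ t) :
    |z ⬝ᵥ ((NormedSpace.exp (-(t • B))) *ᵥ v) - z ⬝ᵥ ((NormedSpace.exp (-(t • ((1 / 2 : ℝ) • (B + Bᵀ))))) *ᵥ v)| ≤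
      τ * hi / 2 * t * Real.exp (-(lo * t)) * (Real.sqrt (z ⬝ᵥ z) * Real.sqrt (v ⬝ᵥ v)) := by
  set H : Matrix (Fin 3) (Fin 3) ℝ := (1 / 2 : ℝ) • (B + Bᵀ) with hHdef
  have hH : H.IsSymm := isSymm_symPart B
  have hwinB : ∀ x : Fin 3 → ℝ, lo * (x ⬝ᵥ x) ≤ x ⬝ᵥ B *ᵥ x := fun x => (hwin x).1
  have hwinH : ∀ x : Fin 3 → ℝ, lo * (x ⬝ᵥ x) ≤ x ⬝ᵥ H *ᵥ x := fun x => by rw [hHdef, form_symPart_self]; exact (hwin x).1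
  have hlohi : lo ≤ hi := lo_le_hi_of_window hwin
  -- the symmetric semigroup is symmetric: `(e^{-tH}z)·v = z·(e^{-tH}v)`
  have hsym : ((NormedSpace.exp (-(t • H))) *ᵥ z) ⬝ᵥ v = z ⬝ᵥ ((NormedSpace.exp (-(t • H))) *ᵥ v) := by
    rw [dotProduct_comm]
    exact (dotProduct_exp_neg_smul_mulVec_comm hH z v t).symm
  rw [← hsym, pairing_identity B H v z t]
  -- uniform bound on the integrand
  have hbound : ∀ r ∈ Set.uIoc (0:ℝ) t,
      ‖(H *ᵥ ((NormedSpace.exp (-((t - r) • H))) *ᵥ z)) ⬝ᵥ ((NormedSpace.exp (-(r • B))) *ᵥ v) -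
        ((NormedSpace.exp (-((t - r) • H))) *ᵥ z) ⬝ᵥ (B *ᵥ ((NormedSpace.exp (-(r • B))) *ᵥ v))‖ ≤
      τ * hi / 2 * Real.exp (-(lo * t)) * (Real.sqrt (z ⬝ᵥ z) * Real.sqrt (v ⬝ᵥ v)) := by
    intro r hr
    rw [Set.uIoc_of_le ht] at hr
    have hr0 : 0 ≤ r := hr.1.le
    have htr : 0 ≤ t - r := by linarith [hr.2]
    set y := (NormedSpace.exp (-((t - r) • H))) *ᵥ z with hy
    set x := (NormedSpace.exp (-(r • B))) *ᵥ v with hx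
    rw [Real.norm_eq_abs, pairing_integrand_eq, hHdef, symPart_transpose_sub, Matrix.smul_mulVec, dotProduct_smul,
      smul_eq_mul, abs_mul, abs_of_nonneg (by norm_num : (0:ℝ) ≤ 1 / 2)]
    have hk := abs_dotProduct_skew_le hτ hlo.le hlohi hsec hwin y x
    have hyb : Real.sqrt (y ⬝ᵥ y) ≤ Real.exp (-(lo * (t - r))) * Real.sqrt (z ⬝ᵥ z) := sqrt_dotProduct_exp_le hwinH z htr
    have hxb : Real.sqrt (x ⬝ᵥ x) ≤ Real.exp (-(lo * r)) * Real.sqrt (v ⬝ᵥ v) := sqrt_dotProduct_exp_le hwinB v hr0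
    have hexp : Real.exp (-(lo * (t - r))) * Real.exp (-(lo * r)) = Real.exp (-(lo * t)) := by
      rw [← Real.exp_add]; ring_nf
    have hprod : Real.sqrt (y ⬝ᵥ y) * Real.sqrt (x ⬝ᵥ x) ≤ Real.exp (-(lo * t)) * (Real.sqrt (z ⬝ᵥ z) * Real.sqrt (v ⬝ᵥ v)) := by
      calc Real.sqrt (y ⬝ᵥ y) * Real.sqrt (x ⬝ᵥ x)
          ≤ (Real.exp (-(lo * (t - r))) * Real.sqrt (z ⬝ᵥ z)) * (Real.exp (-(lo * r)) * Real.sqrt (v ⬝ᵥ v)) :=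
            mul_le_mul hyb hxb (Real.sqrt_nonneg _) (mul_nonneg (Real.exp_pos _).le (Real.sqrt_nonneg _))
        _ = Real.exp (-(lo * t)) * (Real.sqrt (z ⬝ᵥ z) * Real.sqrt (v ⬝ᵥ v)) := by rw [← hexp]; ring
    have hτhi : 0 ≤ τ * hi := mul_nonneg hτ (hlo.le.trans hlohi)
    calc 1 / 2 * |y ⬝ᵥ ((Bᵀ - B) *ᵥ x)| ≤ 1 / 2 * (τ * hi * (Real.sqrt (y ⬝ᵥ y) * Real.sqrt (x ⬝ᵥ x))) :=
          mul_le_mul_of_nonneg_left hk (by norm_num)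
      _ ≤ 1 / 2 * (τ * hi * (Real.exp (-(lo * t)) * (Real.sqrt (z ⬝ᵥ z) * Real.sqrt (v ⬝ᵥ v)))) :=
          mul_le_mul_of_nonneg_left (mul_le_mul_of_nonneg_left hprod hτhi) (by norm_num)
      _ = τ * hi / 2 * Real.exp (-(lo * t)) * (Real.sqrt (z ⬝ᵥ z) * Real.sqrt (v ⬝ᵥ v)) := by ring
  have hI := intervalIntegral.norm_integral_le_of_norm_le_const hbound
  rw [Real.norm_eq_abs, sub_zero, abs_of_nonneg ht] at hI
  calc _ ≤ τ * hi / 2 * Real.exp (-(lo * t)) * (Real.sqrt (z ⬝ᵥ z) * Real.sqrt (v ⬝ᵥ v)) * t := hI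
    _ = τ * hi / 2 * t * Real.exp (-(lo * t)) * (Real.sqrt (z ⬝ᵥ z) * Real.sqrt (v ⬝ᵥ v)) := by ring

/-- **THE DIFFERENCE OF THE TWO SEMIGROUPS**: `w(t) = e^{-tB}v − e^{-tH}v` has `√(w·w) ≤ (τhi/2)·t·e^{-lo t}·√(v·v)` (`t ≥ 0`)
(drift bound tested against `z = w(t)`). [folklore] -/
theorem sqrt_dotProduct_exp_sub_exp_symPart_le {B : Matrix (Fin 3) (Fin 3) ℝ} {τ lo hi : ℝ} (hτ : 0 ≤ τ) (hlo : 0 < lo)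
    (hsec : ∀ x z : Fin 3 → ℝ, (x ⬝ᵥ B *ᵥ z - z ⬝ᵥ B *ᵥ x) ^ 2 ≤ τ ^ 2 * ((x ⬝ᵥ B *ᵥ x) * (z ⬝ᵥ B *ᵥ z)))
    (hwin : ∀ x : Fin 3 → ℝ, lo * (x ⬝ᵥ x) ≤ x ⬝ᵥ B *ᵥ x ∧ x ⬝ᵥ B *ᵥ x ≤ hi * (x ⬝ᵥ x)) (v : Fin 3 → ℝ) {t : ℝ}
    (ht : 0 ≤ t) :
    Real.sqrt (((NormedSpace.exp (-(t • B))) *ᵥ v - (NormedSpace.exp (-(t • ((1 / 2 : ℝ) • (B + Bᵀ))))) *ᵥ v) ⬝ᵥ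
        ((NormedSpace.exp (-(t • B))) *ᵥ v - (NormedSpace.exp (-(t • ((1 / 2 : ℝ) • (B + Bᵀ))))) *ᵥ v)) ≤
      τ * hi / 2 * t * Real.exp (-(lo * t)) * Real.sqrt (v ⬝ᵥ v) := by
  set w := (NormedSpace.exp (-(t • B))) *ᵥ v - (NormedSpace.exp (-(t • ((1 / 2 : ℝ) • (B + Bᵀ))))) *ᵥ v with hw
  have hlohi : lo ≤ hi := lo_le_hi_of_window hwin
  have hc : 0 ≤ τ * hi / 2 * t * Real.exp (-(lo * t)) * Real.sqrt (v ⬝ᵥ v) := by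
    have : 0 ≤ τ * hi := mul_nonneg hτ (hlo.le.trans hlohi)
    positivity
  -- `a ≤ c√a` with `c ≥ 0` forces `√a ≤ c` (as in ad-lit's `QuantumLattice.sqrt_le_of_le_mul_sqrt`)
  suffices hmain : w ⬝ᵥ w ≤ τ * hi / 2 * t * Real.exp (-(lo * t)) * Real.sqrt (v ⬝ᵥ v) * Real.sqrt (w ⬝ᵥ w) by
    rcases le_or_gt (w ⬝ᵥ w) 0 with ha | ha
    · rw [Real.sqrt_eq_zero'.2 ha]; exact hc
    · have hs : 0 < Real.sqrt (w ⬝ᵥ w) := Real.sqrt_pos.2 ha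
      have h2 : Real.sqrt (w ⬝ᵥ w) * Real.sqrt (w ⬝ᵥ w) ≤
          τ * hi / 2 * t * Real.exp (-(lo * t)) * Real.sqrt (v ⬝ᵥ v) * Real.sqrt (w ⬝ᵥ w) := by
        rw [Real.mul_self_sqrt ha.le]; exact hmain
      exact le_of_mul_le_mul_right h2 hs
  have h := abs_dotProduct_exp_sub_exp_symPart_le hτ hlo hsec hwin w v ht
  have heq : w ⬝ᵥ w = w ⬝ᵥ ((NormedSpace.exp (-(t • B))) *ᵥ v) -
      w ⬝ᵥ ((NormedSpace.exp (-(t • ((1 / 2 : ℝ) • (B + Bᵀ))))) *ᵥ v) := by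
    rw [hw, dotProduct_sub]
  rw [heq]
  calc _ ≤ |w ⬝ᵥ ((NormedSpace.exp (-(t • B))) *ᵥ v) - w ⬝ᵥ ((NormedSpace.exp (-(t • ((1 / 2 : ℝ) • (B + Bᵀ))))) *ᵥ v)| :=
        le_abs_self _
    _ ≤ τ * hi / 2 * t * Real.exp (-(lo * t)) * (Real.sqrt (w ⬝ᵥ w) * Real.sqrt (v ⬝ᵥ v)) := h
    _ = τ * hi / 2 * t * Real.exp (-(lo * t)) * Real.sqrt (v ⬝ᵥ v) *
          Real.sqrt (w ⬝ᵥ ((NormedSpace.exp (-(t • B))) *ᵥ v) -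
            w ⬝ᵥ ((NormedSpace.exp (-(t • ((1 / 2 : ℝ) • (B + Bᵀ))))) *ᵥ v)) := by rw [← heq]; ring

/-- **FIRST-ORDER LOWER EDGE, pointwise in time**: sector `τ`, window `[lo, hi]` (`0 < lo`), `t ≥ 0` ⇒
`vᵀe^{-tB}v ≥ (e^{-hi t} − (τhi/2)·t·e^{-lo t})·|v|²` (drift bound at `z = v` + symmetric Loewner pinch on `H`). [folklore] -/
theorem lowerEdge_pointwise_first {B : Matrix (Fin 3) (Fin 3) ℝ} {τ lo hi : ℝ} (hτ : 0 ≤ τ) (hlo : 0 < lo)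
    (hsec : ∀ x z : Fin 3 → ℝ, (x ⬝ᵥ B *ᵥ z - z ⬝ᵥ B *ᵥ x) ^ 2 ≤ τ ^ 2 * ((x ⬝ᵥ B *ᵥ x) * (z ⬝ᵥ B *ᵥ z)))
    (hwin : ∀ x : Fin 3 → ℝ, lo * (x ⬝ᵥ x) ≤ x ⬝ᵥ B *ᵥ x ∧ x ⬝ᵥ B *ᵥ x ≤ hi * (x ⬝ᵥ x)) (v : Fin 3 → ℝ) {t : ℝ}
    (ht : 0 ≤ t) :
    (Real.exp (-(hi * t)) - τ * hi / 2 * t * Real.exp (-(lo * t))) * (v ⬝ᵥ v) ≤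
      v ⬝ᵥ ((NormedSpace.exp (-(t • B))) *ᵥ v) := by
  have hwinH : ∀ x : Fin 3 → ℝ, x ⬝ᵥ ((1 / 2 : ℝ) • (B + Bᵀ)) *ᵥ x ≤ hi * (x ⬝ᵥ x) := fun x => by
    rw [form_symPart_self]; exact (hwin x).2
  have hpinch := exp_mul_le_dotProduct_exp (isSymm_symPart B) hwinH v ht
  have hdrift := abs_dotProduct_exp_sub_exp_symPart_le hτ hlo hsec hwin v v ht
  rw [Real.mul_self_sqrt (by rw [self_dotProduct_eq_sum_sq]; exact Finset.sum_nonneg fun i _ => sq_nonneg _)] at hdrift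
  have h2 := (abs_le.1 hdrift).1
  nlinarith [h2, hpinch]

end Pointwise

end Summit.AnomalousDissipation.AnomalousDissipation.Theorems.SolenoidalFractalHomogenisation.LagrangianStep.OddGain

end
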